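import Mathlib.Tactic

/-!
# The two-regime law for first theta relations: ring identities

Pure algebraic identities behind the W4 note `DBREAK-w4rep2g11.md` (pub-hsemireg, W4, w4-rep-2
gen 11) and step (2) of w4-rep-1 g14's THEOREM Σ (`THEOREM-SIGMA-w4rep1g14.md`).

Setting: a cell `(n; m, 3m)` of the (1,3)-polarised programme; window coordinates
`s = 2m - n`, `t = 2n - 3m` (so `(m,n) = M(s,t)` for the Pell unit `M = ((2,1),(3,2))` of
`diag(3,-1)`); level `k`; `ε₀ = s k - m`; the multiplication map
`H⁰(L) ⊗ H⁰(𝓛_k) → H⁰(L ⊗ N^{nk})` has source dimension `9 m² k²` and target dimension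
`3 (m + n k)²`, so `D♭(k) = 9 m² k² - 3 (m + n k)²`, while the closed-form count is
`D(k) = (3 ε₀)²`.  Mukai vectors are triples `(rank, c₁/ν̄, χ)` with pairing
`⟨(r,c,a),(r',c',a')⟩ = 6 c c' - (r a' + r' a)` (`ν̄² = 6`).

We check, as identities valid in any commutative ring (or field, where a division occurs):
* `M` is a unit of `diag(3,-1)` and `(m,n) = M(s,t)`;
* the kernel vector `(3s², -3sm, 9m²)` and the cokernel vector `(t², 2tm, 12m²)` are isotropic
  and differ by `w = (n² - 3m², nm, 3m²)` (additivity on `0 → 𝒦 → 𝒪^χ → E → 𝒬 → 0`);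
* `rk 𝒦 = 3s² - t² = 3m² - n²`;
* THE TWO-REGIME IDENTITY `D(k) - D♭(k) = 3 (t k + 2 m)²`, and `2c - 3ak = t k + 2 m`
  (w4-rep-1's THEOREM I hypothesis `2c > 3ak` is exactly `k < k* = 2m/(3m-2n)`);
* the Hilbert-function forms `3s²·3·(k - m/s)² = (3ε₀)²` and `t²·3·(k + 2m/t)² = 3(tk+2m)²`;
* THEOREM Σ step (2): with `c = 2ak - ε₀`, `(ak - ε₀)² + ε₀ c = (ak)²`, and the map
  `σ(t,r) = (p t + μ q r, q t - p r)` with `p² + μ q² = 1` is an involution preserving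
  `t² + μ r²` with determinant `-1` (a reflection).
No geometry is formalised; honest framing: nothing here says HC / HC_CM / HC_AV is proved.
-/

namespace Summit.Ventures.HSemireg.TwoRegimeLaw

variable {R : Type*} [CommRing R]

/-- `M = ((2,1),(3,2))` preserves the form `diag(3,-1)`: the three entries of `Mᵀ D M = D`
and `det M = 1`. -/
theorem pell_unit :
    (3 * 2 ^ 2 - 3 ^ 2 : ℤ) = 3 ∧ (3 * 2 * 1 - 3 * 2 : ℤ) = 0 ∧ (3 * 1 ^ 2 - 2 ^ 2 : ℤ) = -1 ∧
      (2 * 2 - 1 * 3 : ℤ) = 1 := by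
  norm_num

/-- Window coordinates invert the Pell unit: `(m,n) = M (s,t)` with `s = 2m-n`, `t = 2n-3m`. -/
theorem window_coords (m n : R) :
    2 * (2 * m - n) + (2 * n - 3 * m) = m ∧ 3 * (2 * m - n) + 2 * (2 * n - 3 * m) = n := by
  constructor <;> ring

/-- The kernel vector `(3s², -3sm, 9m²)` is isotropic: `6 c² = 2 r a`. -/
theorem kernel_vector_isotropic (s m : R) :
    6 * (-(3 * s * m)) ^ 2 = 2 * (3 * s ^ 2) * (9 * m ^ 2) := by
  ring

/-- The cokernel vector `(t², 2tm, 12m²)` is isotropic. -/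
theorem cokernel_vector_isotropic (t m : R) :
    6 * (2 * t * m) ^ 2 = 2 * t ^ 2 * (12 * m ^ 2) := by
  ring

/-- Additivity, rank entry: `3s² + (n² - 3m²) = t²`. -/
theorem additivity_rank (m n : R) :
    3 * (2 * m - n) ^ 2 + (n ^ 2 - 3 * m ^ 2) = (2 * n - 3 * m) ^ 2 := by
  ring

/-- Additivity, `c₁` entry: `-3sm + nm = 2tm`. -/
theorem additivity_c1 (m n : R) :
    -(3 * (2 * m - n) * m) + n * m = 2 * (2 * n - 3 * m) * m := by
  ring

/-- Additivity, `χ` entry: `9m² + 3m² = 12m²`. -/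
theorem additivity_chi (m : R) : 9 * m ^ 2 + 3 * m ^ 2 = 12 * m ^ 2 := by
  ring

/-- The rank of the kernel in window coordinates: `3s² - t² = 3m² - n²`. -/
theorem kernel_rank (m n : R) :
    3 * (2 * m - n) ^ 2 - (2 * n - 3 * m) ^ 2 = 3 * m ^ 2 - n ^ 2 := by
  ring

/-- THE TWO-REGIME IDENTITY: `D(k) - D♭(k) = 3 (tk + 2m)²`, i.e.
`9 (s k - m)² - (9 m² k² - 3 (m + n k)²) = 3 ((2n - 3m) k + 2 m)²` with `s = 2m - n`. -/
theorem two_regime_identity (m n k : R) :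
    9 * ((2 * m - n) * k - m) ^ 2 - (9 * m ^ 2 * k ^ 2 - 3 * (m + n * k) ^ 2)
      = 3 * ((2 * n - 3 * m) * k + 2 * m) ^ 2 := by
  ring

/-- Consequently the closed-form count and the trivial bound coincide exactly where
`t k + 2 m = 0` (the level `k* = 2m/(3m-2n)`). -/
theorem counts_touch (m n k : R) (h : (2 * n - 3 * m) * k + 2 * m = 0) :
    9 * ((2 * m - n) * k - m) ^ 2 = 9 * m ^ 2 * k ^ 2 - 3 * (m + n * k) ^ 2 := by
  have e := two_regime_identity m n k
  rw [h] at e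
  linear_combination e

/-- THEOREM I's hypothesis `2c > 3ak` (with `a = m`, `c = m + nk`) is the condition `k < k*`:
`2(m + nk) - 3mk = t k + 2m` with `t = 2n - 3m`. -/
theorem theoremI_threshold (m n k : R) :
    2 * (m + n * k) - 3 * m * k = (2 * n - 3 * m) * k + 2 * m := by
  ring

/-- Hilbert-function form of the kernel count over a field: `rk · d · (k - m/s)² = (3ε₀)²`
with `rk = 3s²`, `d = 3`, `ε₀ = sk - m`, `s ≠ 0`. -/
theorem hilbert_kernel {F : Type*} [Field F] (s m k : F) (hs : s ≠ 0) :
    3 * s ^ 2 * 3 * (k - m / s) ^ 2 = (3 * (s * k - m)) ^ 2 := by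
  field_simp

/-- Hilbert-function form of the cokernel count over a field:
`t² · 3 · (k + 2m/t)² = 3 (tk + 2m)²`, `t ≠ 0`. -/
theorem hilbert_cokernel {F : Type*} [Field F] (t m k : F) (ht : t ≠ 0) :
    t ^ 2 * 3 * (k + 2 * m / t) ^ 2 = 3 * (t * k + 2 * m) ^ 2 := by
  field_simp

/-- THEOREM Σ, step (2): with `c = 2ak - ε₀` one has `(ak - ε₀)² + ε₀ c = (ak)²`, which makes the
reflection `σ` rational with denominator `ak`. -/
theorem sigma_denominator (a k e c : R) (h : c = 2 * a * k - e) :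
    (a * k - e) ^ 2 + e * c = (a * k) ^ 2 := by
  subst h
  ring

/-- The map `σ(t,r) = (p t + μ q r, q t - p r)` with `p² + μ q² = 1` preserves `t² + μ r²`. -/
theorem sigma_isometry (p q μ t r : R) (h : p ^ 2 + μ * q ^ 2 = 1) :
    (p * t + μ * q * r) ^ 2 + μ * (q * t - p * r) ^ 2 = t ^ 2 + μ * r ^ 2 := by
  linear_combination (t ^ 2 + μ * r ^ 2) * h

/-- … and is an involution (first coordinate). -/
theorem sigma_involution_fst (p q μ t r : R) (h : p ^ 2 + μ * q ^ 2 = 1) :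
    p * (p * t + μ * q * r) + μ * q * (q * t - p * r) = t := by
  linear_combination t * h

/-- … and is an involution (second coordinate). -/
theorem sigma_involution_snd (p q μ t r : R) (h : p ^ 2 + μ * q ^ 2 = 1) :
    q * (p * t + μ * q * r) - p * (q * t - p * r) = r := by
  linear_combination r * h

/-- … with determinant `-1`: a reflection. -/
theorem sigma_det (p q μ : R) (h : p ^ 2 + μ * q ^ 2 = 1) :
    p * (-p) - (μ * q) * q = -1 := by
  linear_combination -h

/-- The concrete instance of THEOREM Σ's headline cell `(13;8,24)`, `k = 3`: `a k = 24`, `ε₀ = 1`,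
`c = 47`, `p = 23/24`, `q = 47/24`, `μ q = 1/24`, so `μ = 1/47` and `p² + μ q² = 1`. -/
theorem sigma_instance_13_8_24 :
    ((23 : ℚ) / 24) ^ 2 + (1 / 47) * ((47 : ℚ) / 24) ^ 2 = 1 := by
  norm_num

/-- The concrete instance for `(11;7,21)`, `k = 3`: `a k = 21`, `ε₀ = 2`, `c = 40`,
`σ(t,r) = ((19 t + r)/21, (80 t - 19 r)/21)`: `p = 19/21`, `q = 80/21`, `μ q = 1/21`,
`μ = 1/80`. -/
theorem sigma_instance_11_7_21 :
    ((19 : ℚ) / 21) ^ 2 + (1 / 80) * ((80 : ℚ) / 21) ^ 2 = 1 := by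
  norm_num

end Summit.Ventures.HSemireg.TwoRegimeLaw
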